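import Mathlib
import HarnessLib
import Literature.Computability.AlgebraicComplexity.PatternExpressions
import Summits.ValiantsHypothesis.ValiantsHypothesis.Theorems.MonotoneRestorationOrbitCompressionQPOneRowStratum

/-!
# Route MonotoneRestoration — aside `OrbitCompressionQP` (stmt-ValiantsHypothesis-18332), line
# `expression_compression`: SYMMETRIC `VQP` FUNCTIONS OF AN EQUIVARIANT ROW GADGET are narrow of
# quasi-polynomial length

Hand `-3 g1` proved that the row product `Π_i Σ_j x_ij = e_n(r)` and the elementary symmetric polynomials
`e_d(r)` of the row sums `r_i = Σ_j x_ij` are narrow of quasi-polynomial length (Newton + balancing).  With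
Bläser–Jindal (proved in the tree) and the `VQP` substitution principle this extends from `e_d` to EVERY
`VQP` family of symmetric polynomials, and from row sums to every EQUIVARIANT ROW GADGET — a `(1,1)`-label
expression `W_n` of quasi-polynomial length whose value at `(ρ, γ)` is a polynomial `w_n(ρ 0)` of the row
`ρ 0` alone (row sums, row power sums, `Σ_j x_ij c_j` with `c_j` the column sums, …):

* `exists_pow` — powers of an expression; `exists_gadgetPowerSum` — `Σ_i w_n(i)^b` as a closed-valued
  expression;
* ★ `narrowQP_symmetric_of_rowGadget` — for `h_n ∈ ℂ[y_0, …, y_{n-1}]^{S_n}` a `VQP` family and `W_n` an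
  equivariant row gadget, `n ↦ h_n(w_n(0), …, w_n(n-1))` satisfies the conclusion of
  `stub_narrowExpressionCompression` (`(1,1)` labels).  Mechanism: power sums of the gadget → Newton
  substituends `e_j(w)` (`FormulaSubstitution.exists_esymm_subst`) → symmetric core `P_n` of `h_n`, a `VQP`
  family by `isVQPFamily_symmetricCore` (Bläser–Jindal) → substitution principle → normalisation.

Helper file (`--supports stmt-ValiantsHypothesis-18332`); def-free; nothing here is a named fact; no registered
stub is closed; VP ≠ VNP is not moved.
-/

noncomputable section

open MvPolynomial

-- `Summit.ValiantsHypothesis.ValiantsHypothesis.…` is the tree's single-conjunct layout (Sub = Summit).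
set_option linter.dupNamespace false

namespace Summit.ValiantsHypothesis.ValiantsHypothesis.Theorems

namespace FormulaSubstitution

open Literature.Computability.AlgebraicComplexity

section SingleLevel

variable {F : Type} [CommSemiring F] {k l : ℕ}

/-- Powers of an expression: length `b (|e| + 1) + 1`, value `(value e)^b`. [folklore] -/
theorem exists_pow (e : PatternExpr F k l) (b : ℕ) :
    ∃ q : PatternExpr F k l, q.length = b * (e.length + 1) + 1 ∧
      ∀ (n : ℕ) (ρ : Fin k → Fin n) (γ : Fin l → Fin n), q.value n ρ γ = (e.value n ρ γ) ^ b := by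
  induction b with
  | zero => exact ⟨PatternExpr.const 1, by simp [PatternExpr.length], fun n ρ γ => by simp⟩
  | succ b ih =>
    obtain ⟨q, hl, hv⟩ := ih
    exact ⟨PatternExpr.mul e q, by simp [PatternExpr.length, hl]; ring,
      fun n ρ γ => by simp [hv, pow_succ']⟩

/-- **Power sums of a row gadget**: if the value of `W` at `(ρ, γ)` is `w (ρ 0)`, then `sumRow 0 (W^b)` has
the constant value `Σ_i (w i)^b` and length `b (|W| + 1) + 2`. [folklore] -/
theorem exists_gadgetPowerSum {n : ℕ} (W : PatternExpr F 1 1) (w : Fin n → MvPolynomial (Fin n × Fin n) F)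
    (hW : ∀ (ρ γ : Fin 1 → Fin n), W.value n ρ γ = w (ρ 0)) (b : ℕ) :
    ∃ q : PatternExpr F 1 1, q.length = b * (W.length + 1) + 2 ∧
      ∀ (ρ γ : Fin 1 → Fin n), q.value n ρ γ = ∑ i : Fin n, (w i) ^ b := by
  obtain ⟨q, hl, hv⟩ := exists_pow W b
  refine ⟨PatternExpr.sumRow 0 q, by simp [PatternExpr.length, hl], fun ρ γ => ?_⟩
  simp only [PatternExpr.value_sumRow, hv, hW, Function.update_self]

end SingleLevel

section Strata

/-- Arithmetic for the Newton substituends over a gadget of quasi-polynomial length. [folklore] -/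
theorem gadget_esymm_length_qp (a : ℕ) : ∃ c : ℕ, ∀ n Λ : ℕ, 1 ≤ n → Λ ≤ 2 ^ ((Nat.log 2 n + a) ^ a) →
    (2 * (n + 1) + 2) ^ (Nat.log 2 n + 1) * ((n * (Λ + 1) + 2) + 2 + (n + 1) + 1) ≤
      2 ^ ((Nat.log 2 n + c) ^ c) := by
  obtain ⟨c₀, hc₀⟩ := NarrowClosure.qp_combine 2 a
  obtain ⟨c, hc⟩ := NarrowClosure.matrixProduct_length_qp c₀
  refine ⟨c, fun n Λ hn hΛ => ?_⟩
  have hX : n ^ 1 + 1 ≤ 2 ^ ((Nat.log 2 n + 2) ^ 2) := CompressionFloors.pbounded_le_qp n 1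
  have h1 := hc₀ (Nat.log 2 n) (n + 1) Λ (by simpa using hX) hΛ
  have hB : n * (Λ + 1) + 4 ≤ 2 ^ ((Nat.log 2 n + c₀) ^ c₀) := by nlinarith
  have h := hc (Nat.log 2 n) (n + 1) n (n * (Λ + 1) + 4) (by nlinarith) (by nlinarith) hB
  have heq : (n * (Λ + 1) + 2) + 2 + (n + 1) + 1 = (n * (Λ + 1) + 4) + (n + 1) + 1 := by ring
  rw [heq]
  omega

/-- ★ **Symmetric `VQP` functions of an equivariant row gadget are narrow of quasi-polynomial length.**
Let `h_n ∈ ℂ[y_0, …, y_{n-1}]` be symmetric with `(h_n)` a `VQP` family, and let `W_n` be `(1,1)`-label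
pattern expressions of quasi-polynomial length whose value at `(ρ, γ)` is `w_n(ρ 0)` (a polynomial of the
row `ρ 0` alone, e.g. the row sum).  Then `n ↦ h_n(w_n(0), …, w_n(n-1))` satisfies the conclusion of
`stub_narrowExpressionCompression`.  (For `h_n = e_n` and `w_n(i) = Σ_j x_ij` this is the row product
`Π_i Σ_j x_ij` of `NarrowClosure.narrowQP_rowProduct`.) [cite: BlaserJindal2019, Thm. 4] -/
theorem narrowQP_symmetric_of_rowGadget (h : (n : ℕ) → MvPolynomial (Fin n) ℂ)
    (hsymm : ∀ n, (h n).IsSymmetric) (hh : IsVQPFamily h)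
    (W : ℕ → PatternExpr ℂ 1 1) (w : (n : ℕ) → Fin n → MvPolynomial (Fin n × Fin n) ℂ)
    (hW : ∃ c : ℕ, ∀ n : ℕ, 1 ≤ n → (W n).length ≤ 2 ^ ((Nat.log 2 n + c) ^ c) ∧
      ∀ (ρ γ : Fin 1 → Fin n), (W n).value n ρ γ = w n (ρ 0)) :
    ∃ c : ℕ, ∀ n : ℕ, 1 ≤ n → ∃ (k l : ℕ) (e : PatternExpr ℂ k l),
      n ^ (k + l) ≤ 2 ^ ((Nat.log 2 n + c) ^ c) ∧ e.length ≤ 2 ^ ((Nat.log 2 n + c) ^ c) ∧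
      e.close n = aeval (w n) (h n) := by
  classical
  -- symmetric cores, a `VQP` family by Bläser–Jindal
  choose P hP using fun n => exists_symmetricCore (h n) (hsymm n)
  have hPq : IsVQPFamily P := isVQPFamily_symmetricCore h P hP hh
  obtain ⟨a, ha⟩ := hW
  -- Newton substituends `e_j(w_n)` as closed-valued `(1,1)`-expressions, for `n ≥ 1`
  have hsub : ∀ n : ℕ, ∃ E : ℕ → PatternExpr ℂ 1 1, 1 ≤ n → ∀ j : ℕ, j ≤ n →
      (E j).length ≤ (2 * (n + 1) + 2) ^ (Nat.log 2 n + 1) *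
        ((n * ((W n).length + 1) + 2) + 2 + (n + 1) + 1) ∧
      ∀ (ρ γ : Fin 1 → Fin n), (E j).value n ρ γ = aeval (w n) (esymm (Fin n) ℂ j) := by
    intro n
    by_cases hn : 1 ≤ n
    swap
    · exact ⟨fun _ => PatternExpr.const 0, fun h1 => absurd h1 hn⟩
    choose pw hpwl hpwv using fun b : ℕ => exists_gadgetPowerSum (W n) (w n) (ha n hn).2 b
    obtain ⟨E, hE⟩ := exists_esymm_subst (ι := Fin n) (k := 1) (l := 1) n n (n * ((W n).length + 1) + 2)
      (fun i _ _ => w n i) pw fun b hb => ⟨by rw [hpwl]; nlinarith, fun ρ γ => hpwv b ρ γ⟩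
    exact ⟨E, fun _ j hj => hE j hj⟩
  choose E hE using hsub
  have hθ : ∃ c : ℕ, ∀ n : ℕ, 1 ≤ n → ∀ j : Fin n,
      (E n (j.val + 1)).length ≤ 2 ^ ((Nat.log 2 n + c) ^ c) := by
    obtain ⟨c, hc⟩ := gadget_esymm_length_qp a
    exact ⟨c, fun n hn j => ((hE n hn (j.val + 1) (by omega)).1).trans (hc n _ hn (ha n hn).1)⟩
  obtain ⟨c₁, hc₁⟩ := exists_narrow_subst_of_isVQPFamily (m := fun n => n) P hPq
    (k := fun _ => 1) (l := fun _ => 1) (fun n j => E n (j.val + 1)) hθ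
  obtain ⟨c₂, hc₂⟩ := NarrowClosure.qp_combine c₁ 0
  refine ⟨max c₂ 3, fun n hn => ?_⟩
  obtain ⟨e, hl, hv⟩ := hc₁ n hn
  have hval : ∀ (ρ γ : Fin 1 → Fin n), e.value n ρ γ = aeval (w n) (h n) := by
    intro ρ γ
    have hfun : (fun j : Fin n => (E n (j.val + 1)).value n ρ γ) =
        fun j : Fin n => aeval (w n) (esymm (Fin n) ℂ (j.val + 1)) :=
      funext fun j => (hE n hn (j.val + 1) (by omega)).2 ρ γ
    rw [hv, hfun, ← hP n, ← AlgHom.comp_apply, comp_aeval]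
  obtain ⟨e', hl', hc'⟩ := exists_close_eq_of_value_const hn e _ hval
  refine ⟨1, 1, e', ?_, ?_, hc'⟩
  · calc n ^ (1 + 1) ≤ n ^ 2 + 2 := by norm_num
      _ ≤ 2 ^ ((Nat.log 2 n + 3) ^ 3) := CompressionFloors.pbounded_le_qp n 2
      _ ≤ 2 ^ ((Nat.log 2 n + max c₂ 3) ^ max c₂ 3) :=
          Nat.pow_le_pow_right (by norm_num) (CompressionFloors.polylog_mono (le_max_right _ _))
  · have h2 := hc₂ (Nat.log 2 n) e.length 0 hl (by simp)
    calc e'.length = e.length + 2 := hl'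
      _ ≤ (e.length + 2) * (0 + 2) := by omega
      _ ≤ 2 ^ ((Nat.log 2 n + c₂) ^ c₂) := h2
      _ ≤ 2 ^ ((Nat.log 2 n + max c₂ 3) ^ max c₂ 3) :=
          Nat.pow_le_pow_right (by norm_num) (CompressionFloors.polylog_mono (le_max_left _ _))

/-- **Example gadget: the row sums.** For every `VQP` family of symmetric polynomials `h_n`,
`n ↦ h_n(r_0, …, r_{n-1})`, `r_i = Σ_j x_ij`, is narrow of quasi-polynomial length. [cite: BlaserJindal2019, Thm. 4] -/
theorem narrowQP_symmetric_of_rowSums (h : (n : ℕ) → MvPolynomial (Fin n) ℂ)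
    (hsymm : ∀ n, (h n).IsSymmetric) (hh : IsVQPFamily h) :
    ∃ c : ℕ, ∀ n : ℕ, 1 ≤ n → ∃ (k l : ℕ) (e : PatternExpr ℂ k l),
      n ^ (k + l) ≤ 2 ^ ((Nat.log 2 n + c) ^ c) ∧ e.length ≤ 2 ^ ((Nat.log 2 n + c) ^ c) ∧
      e.close n = aeval (fun i : Fin n => ∑ j : Fin n, (X (i, j) : MvPolynomial (Fin n × Fin n) ℂ))
        (h n) := by
  refine narrowQP_symmetric_of_rowGadget h hsymm hh
    (fun _ => PatternExpr.sumCol 0 (PatternExpr.edge 0 0))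
    (fun n i => ∑ j : Fin n, (X (i, j) : MvPolynomial (Fin n × Fin n) ℂ)) ⟨2, fun n _ => ⟨?_, ?_⟩⟩
  · have : (Nat.log 2 n + 2) ^ 2 ≥ 2 := by
      have h4 : 2 ^ 2 ≤ (Nat.log 2 n + 2) ^ 2 := Nat.pow_le_pow_left (by omega) 2
      omega
    calc (PatternExpr.sumCol 0 (PatternExpr.edge 0 0) : PatternExpr ℂ 1 1).length = 2 := by
          simp [PatternExpr.length]
      _ ≤ 2 ^ 2 := by norm_num
      _ ≤ 2 ^ ((Nat.log 2 n + 2) ^ 2) := Nat.pow_le_pow_right (by norm_num) this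
  · intro ρ γ
    simp

end Strata

end FormulaSubstitution

end Summit.ValiantsHypothesis.ValiantsHypothesis.Theorems

end
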